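import Summits.Ventures.LatticeQCDFlow.TrivializingMaps.AnnealingAnyGroup
import Summits.Ventures.LatticeQCDFlow.TrivializingMaps.HaarTraceMomentsSUn

/-!
HONEST FRAMING: exact (Metropolis-corrected) sampling algorithms for lattice gauge theory; figures
of merit are autocorrelation/cost numbers at stated couplings and volumes; no continuum-physics
claim.

# UNHaarTraceMoments — `∫_{U(N)} tr g dg = 0`, `∫ (tr g)² dg = 0`, `∫ |tr g|² dg = 1`, HENCE
# `Var_Haar(Re tr) = ½` ON `U(N)` FOR EVERY `N ≥ 1` (lean-2 GEN-9, ours; the `U(N)` Wilson-theory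
# consequences — Fisher zero `|s₀| ≤ 8N` in every volume, extensive zeros, specific heat `½ + O(x)`,
# reweighting law — are the sequel `UNWilsonFisherZero`)

Venture-side (OURS).  Cell `lqcd-flow` (pub-lqcd), unit `pub-lqcd-lean-2-g9`, 2026-08-22.  The `U(N)`
instances of the every-compact-group files of GEN-8 (`PlaquetteDecorrelation`, `WilsonFisherZerosAnyGroup`,
`SpecificHeatAnyGroup`, `AnnealingAnyGroup`), which need one number: the Haar variance of `Re tr` in the
defining representation `unitaryFundamentalRep`.  It is `½` for EVERY `N ≥ 1` (for `SU(n)` the tree has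
`1` at `n = 2`, `½` for `n ≥ 3`; the difference is the centre: `U(N)` contains `i·1`, whose square is
not `1`, so `∫ (tr g)² dg = 0` already at `N = 1, 2`).  No Peter–Weyl: only translation invariance of
Haar under explicit elements of `U(N)` (signed transpositions, diagonal circles, the scalar `i·1`).

* §1 `un_integral_normSq_entry` (`∫ |g_ij|² = 1/N`), `un_integral_diag_mul_conj_diag_eq_zero`
  (`∫ g_ii conj g_kk = 0`, `i ≠ k`), **`un_integral_normSq_trace`** (`∫ |tr g|² = 1`, `N ≥ 1`),
  **`un_integral_trace_eq_zero`**, **`un_integral_trace_sq_eq_zero`** (every `N`; central `i·1`),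
  **`un_haarSqReTrace_eq_half`**, **`un_variance_re_trace`** (`Var_Haar(Re tr) = ½`, `N ≥ 1`).
* §2 (sequel `UNWilsonFisherZero`) the `U(N)` Wilson theory in every volume.

NOT CLAIMED: higher moments (`∫ |tr g|^{2k} = k!` for `k ≤ N` needs Weingarten calculus); anything about
`SU(n)` (the tree: `HaarTraceMomentsSUn`, `PlaquetteHaarMoments`).  Literature grade (cell rule): the
moments are classical (Diaconis–Shahshahani 1994: `∫_{U(N)}|tr g|² = 1`, `∫ tr g = ∫ (tr g)² = 0`); new
typing only, no new theorem.
-/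

open MeasureTheory ProbabilityTheory Filter Topology Complex Set Metric MeromorphicOn
open Literature.MathematicalPhysics.QuantumFieldTheory
open Literature.MathematicalPhysics.QuantumFieldTheory.Luscher2010
open Literature.MathematicalPhysics.QuantumLattice (pairFun sSwapMatrix sSwapMatrix_mem
  diagonal_pairFun_mem unitaryFundamentalRep unitaryFundamentalRep_apply
  continuous_unitaryFundamentalRep)
open scoped Matrix ComplexConjugate

namespace Summit.Ventures.LatticeQCDFlow.TrivializingMaps

/-! ## §1 Haar trace moments on `U(N)` -/

section Haar

variable {N : ℕ}

/-- `U(N)` is second countable (a subspace of the matrices); stated as a theorem (no global instance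
on a Mathlib type), used through `haveI`. [folklore] -/
theorem unitaryGroup_secondCountableTopology : SecondCountableTopology (Matrix.unitaryGroup (Fin N) ℂ) := by
  haveI : SecondCountableTopology (Matrix (Fin N) (Fin N) ℂ) :=
    inferInstanceAs (SecondCountableTopology (Fin N → Fin N → ℂ))
  exact Topology.IsEmbedding.subtypeVal.secondCountableTopology

/-- Continuous complex functions on `U(N)` are Haar-integrable. [folklore] -/
theorem integrable_haarUN_of_continuous {f : Matrix.unitaryGroup (Fin N) ℂ → ℂ}
    (hf : Continuous f) : Integrable f (haarProbability (Matrix.unitaryGroup (Fin N) ℂ)) := by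
  haveI := unitaryGroup_secondCountableTopology (N := N)
  exact (BoundedContinuousFunction.mkOfCompact ⟨_, hf⟩).integrable _

/-- Continuous real functions on `U(N)` are Haar-integrable. [folklore] -/
theorem integrable_haarUN_of_continuous_real {f : Matrix.unitaryGroup (Fin N) ℂ → ℝ}
    (hf : Continuous f) : Integrable f (haarProbability (Matrix.unitaryGroup (Fin N) ℂ)) := by
  haveI := unitaryGroup_secondCountableTopology (N := N)
  exact (BoundedContinuousFunction.mkOfCompact ⟨_, hf⟩).integrable _

/-- A matrix entry is a continuous function on `U(N)`. [folklore] -/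
theorem continuous_UN_entry (i j : Fin N) :
    Continuous fun U : Matrix.unitaryGroup (Fin N) ℂ => (U : Matrix (Fin N) (Fin N) ℂ) i j :=
  (continuous_apply_apply i j).comp continuous_subtype_val

/-- **Column symmetry of the entry moments on `U(N)`**: `∫ |U_ia|² = ∫ |U_ib|²` (right invariance of
Haar under the signed transposition `sSwap a b ∈ SU(N) ⊆ U(N)`). [folklore] -/
theorem un_integral_normSq_entry_eq_of_ne (i : Fin N) {a b : Fin N} (hab : a ≠ b) :
    ∫ U, Complex.normSq ((U : Matrix (Fin N) (Fin N) ℂ) i a)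
        ∂(haarProbability (Matrix.unitaryGroup (Fin N) ℂ)) =
      ∫ U, Complex.normSq ((U : Matrix (Fin N) (Fin N) ℂ) i b)
        ∂(haarProbability (Matrix.unitaryGroup (Fin N) ℂ)) := by
  set S : Matrix.unitaryGroup (Fin N) ℂ :=
    ⟨sSwapMatrix a b, Matrix.specialUnitaryGroup_le_unitaryGroup (sSwapMatrix_mem a b)⟩ with hSdef
  have key := integral_mul_right_eq_self (μ := haarProbability (Matrix.unitaryGroup (Fin N) ℂ))
    (fun U : Matrix.unitaryGroup (Fin N) ℂ => Complex.normSq ((U : Matrix (Fin N) (Fin N) ℂ) i a)) S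
  have hentry : ∀ U : Matrix.unitaryGroup (Fin N) ℂ,
      ((U * S : Matrix.unitaryGroup (Fin N) ℂ) : Matrix (Fin N) (Fin N) ℂ) i a =
        (U : Matrix (Fin N) (Fin N) ℂ) i b := fun U => by
    show ((U : Matrix (Fin N) (Fin N) ℂ) * sSwapMatrix a b) i a = _
    unfold sSwapMatrix
    rw [if_neg hab, ← mul_assoc, Matrix.mul_swap_apply_left, Matrix.mul_diagonal,
      Function.update_of_ne (Ne.symm hab), Pi.one_apply, mul_one]
  simp only [hentry] at key
  exact key.symm

/-- **Rows of a unitary matrix have unit norm**: `∑_j |U_ij|² = 1` on `U(N)`. [folklore] -/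
theorem sum_normSq_row_UN (U : Matrix.unitaryGroup (Fin N) ℂ) (i : Fin N) :
    ∑ j, Complex.normSq ((U : Matrix (Fin N) (Fin N) ℂ) i j) = 1 := by
  have hU : (U : Matrix (Fin N) (Fin N) ℂ) * star (U : Matrix (Fin N) (Fin N) ℂ) = 1 :=
    Matrix.mem_unitaryGroup_iff.mp U.2
  have h := congrFun (congrFun hU i) i
  rw [Matrix.mul_apply, Matrix.one_apply_eq] at h
  have h' : ∑ j, ((Complex.normSq ((U : Matrix (Fin N) (Fin N) ℂ) i j) : ℝ) : ℂ) = 1 := by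
    rw [← h]
    refine Finset.sum_congr rfl fun j _ => ?_
    rw [Matrix.star_apply, Complex.star_def, Complex.mul_conj]
  exact_mod_cast h'

/-- **`∫_{U(N)} |U_ij|² dU = 1/N`** (`N ≥ 1`). [folklore] -/
theorem un_integral_normSq_entry (hN : 1 ≤ N) (i j : Fin N) :
    ∫ U, Complex.normSq ((U : Matrix (Fin N) (Fin N) ℂ) i j)
        ∂(haarProbability (Matrix.unitaryGroup (Fin N) ℂ)) = 1 / N := by
  set μ := haarProbability (Matrix.unitaryGroup (Fin N) ℂ) with hμ
  have hall : ∀ j' : Fin N, ∫ U, Complex.normSq ((U : Matrix (Fin N) (Fin N) ℂ) i j') ∂μ =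
      ∫ U, Complex.normSq ((U : Matrix (Fin N) (Fin N) ℂ) i j) ∂μ := fun j' => by
    by_cases h : j' = j
    · rw [h]
    · exact un_integral_normSq_entry_eq_of_ne i h
  have hint : ∀ j' : Fin N, Integrable (fun U : Matrix.unitaryGroup (Fin N) ℂ =>
      Complex.normSq ((U : Matrix (Fin N) (Fin N) ℂ) i j')) μ := fun j' =>
    integrable_haarUN_of_continuous_real (Complex.continuous_normSq.comp (continuous_UN_entry i j'))
  have hsum : ∑ j', ∫ U, Complex.normSq ((U : Matrix (Fin N) (Fin N) ℂ) i j') ∂μ = 1 := by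
    rw [← integral_finsetSum _ fun j' _ => hint j']
    simp only [sum_normSq_row_UN, integral_const, smul_eq_mul, probReal_univ, one_mul]
  simp only [hall, Finset.sum_const, Finset.card_univ, Fintype.card_fin, nsmul_eq_mul] at hsum
  have hn0 : (N : ℝ) ≠ 0 := by exact_mod_cast (show N ≠ 0 by omega)
  field_simp
  linarith

/-- **Off-diagonal decorrelation on `U(N)`**: `∫ U_ii · conj(U_kk) dU = 0` for `i ≠ k` (left
invariance under the diagonal element with `i` at `i` and `-i` at `k`). [folklore] -/
theorem un_integral_diag_mul_conj_diag_eq_zero {i k : Fin N} (hik : i ≠ k) :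
    ∫ U, (U : Matrix (Fin N) (Fin N) ℂ) i i * conj ((U : Matrix (Fin N) (Fin N) ℂ) k k)
      ∂(haarProbability (Matrix.unitaryGroup (Fin N) ℂ)) = 0 := by
  set μ := haarProbability (Matrix.unitaryGroup (Fin N) ℂ) with hμ
  set w : Circle := ⟨I, by simp [Submonoid.unitSphere]⟩ with hwdef
  have hwI : (w : ℂ) = I := rfl
  set D : Matrix.unitaryGroup (Fin N) ℂ :=
    ⟨Matrix.diagonal (pairFun i k (w : ℂ)),
      Matrix.specialUnitaryGroup_le_unitaryGroup (diagonal_pairFun_mem i k w)⟩ with hDdef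
  have hDi : pairFun i k (w : ℂ) i = I := by
    simp [pairFun, hwI, hik]
  have hDk : pairFun i k (w : ℂ) k = -I := by
    simp [pairFun, hwI, hik.symm, Complex.inv_I]
  have key := integral_mul_left_eq_self (μ := μ)
    (fun U : Matrix.unitaryGroup (Fin N) ℂ =>
      (U : Matrix (Fin N) (Fin N) ℂ) i i * conj ((U : Matrix (Fin N) (Fin N) ℂ) k k)) D
  have hent : ∀ (U : Matrix.unitaryGroup (Fin N) ℂ) (m : Fin N),
      ((D * U : Matrix.unitaryGroup (Fin N) ℂ) : Matrix (Fin N) (Fin N) ℂ) m m =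
        pairFun i k (w : ℂ) m * (U : Matrix (Fin N) (Fin N) ℂ) m m := fun U m => by
    show (Matrix.diagonal (pairFun i k (w : ℂ)) * (U : Matrix (Fin N) (Fin N) ℂ)) m m = _
    rw [Matrix.diagonal_mul]
  simp only [hent, hDi, hDk, map_mul, map_neg, Complex.conj_I, neg_neg] at key
  have hneg : ∫ U, I * (U : Matrix (Fin N) (Fin N) ℂ) i i *
      (I * conj ((U : Matrix (Fin N) (Fin N) ℂ) k k)) ∂μ =
      -∫ U, (U : Matrix (Fin N) (Fin N) ℂ) i i * conj ((U : Matrix (Fin N) (Fin N) ℂ) k k) ∂μ := by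
    rw [← integral_neg]
    refine integral_congr_ae (ae_of_all _ fun U => ?_)
    linear_combination ((U : Matrix (Fin N) (Fin N) ℂ) i i * conj ((U : Matrix (Fin N) (Fin N) ℂ) k k))
      * Complex.I_mul_I
  rw [hneg] at key
  linear_combination (-(1 : ℂ) / 2) * key

/-- **`∫_{U(N)} |tr U|² dU = 1`** (`N ≥ 1`; the defining representation is irreducible — here by
hand: the diagonal circles kill the off-diagonal terms, the signed transpositions equalise the
diagonal ones). [folklore] -/
theorem un_integral_normSq_trace (hN : 1 ≤ N) :
    ∫ U, Complex.normSq ((U : Matrix (Fin N) (Fin N) ℂ)).trace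
      ∂(haarProbability (Matrix.unitaryGroup (Fin N) ℂ)) = 1 := by
  set μ := haarProbability (Matrix.unitaryGroup (Fin N) ℂ) with hμ
  have hexp : ∀ U : Matrix.unitaryGroup (Fin N) ℂ,
      ((U : Matrix (Fin N) (Fin N) ℂ)).trace * conj ((U : Matrix (Fin N) (Fin N) ℂ)).trace =
        ∑ k, ∑ i, (U : Matrix (Fin N) (Fin N) ℂ) i i * conj ((U : Matrix (Fin N) (Fin N) ℂ) k k) :=
    fun U => by
      simp only [Matrix.trace, Matrix.diag_apply, map_sum, Finset.sum_mul, Finset.mul_sum]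
  have hint : ∀ i k : Fin N, Integrable (fun U : Matrix.unitaryGroup (Fin N) ℂ =>
      (U : Matrix (Fin N) (Fin N) ℂ) i i * conj ((U : Matrix (Fin N) (Fin N) ℂ) k k)) μ := fun i k =>
    integrable_haarUN_of_continuous ((continuous_UN_entry i i).mul
      (Complex.continuous_conj.comp (continuous_UN_entry k k)))
  have hdiag : ∀ k : Fin N, ∑ i, ∫ U, (U : Matrix (Fin N) (Fin N) ℂ) i i *
      conj ((U : Matrix (Fin N) (Fin N) ℂ) k k) ∂μ = ((1 / N : ℝ) : ℂ) := fun k => by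
    rw [Finset.sum_eq_single k (fun i _ hik => un_integral_diag_mul_conj_diag_eq_zero hik)
      (fun h => absurd (Finset.mem_univ k) h)]
    simp_rw [Complex.mul_conj]
    rw [integral_complex_ofReal, un_integral_normSq_entry hN k k]
  have hC : ∫ U, ((U : Matrix (Fin N) (Fin N) ℂ)).trace * conj ((U : Matrix (Fin N) (Fin N) ℂ)).trace ∂μ
      = 1 := by
    simp only [hexp]
    rw [integral_finsetSum _ fun k _ => integrable_finsetSum _ fun i _ => hint i k]
    simp_rw [integral_finsetSum _ fun i _ => hint i _]
    simp only [hdiag, Finset.sum_const, Finset.card_univ, Fintype.card_fin, nsmul_eq_mul]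
    have hn0 : (N : ℂ) ≠ 0 := by exact_mod_cast (show N ≠ 0 by omega)
    push_cast
    field_simp
  have h2 : ∫ U, ((Complex.normSq ((U : Matrix (Fin N) (Fin N) ℂ)).trace : ℝ) : ℂ) ∂μ = 1 := by
    rw [← hC]
    refine integral_congr_ae (ae_of_all _ fun U => ?_)
    simp only [Complex.mul_conj]
  rw [integral_complex_ofReal] at h2
  exact_mod_cast h2

/-- The scalar `i·1 ∈ U(N)` (every `N`). [folklore] -/
theorem I_smul_one_mem_unitaryGroup :
    (I : ℂ) • (1 : Matrix (Fin N) (Fin N) ℂ) ∈ Matrix.unitaryGroup (Fin N) ℂ := by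
  rw [Matrix.mem_unitaryGroup_iff, star_smul, star_one, Matrix.smul_mul, Matrix.mul_smul, one_mul,
    smul_smul, Complex.star_def, Complex.conj_I, mul_neg, Complex.I_mul_I, neg_neg, one_smul]

/-- `tr((i·1) U) = i · tr U` for the central element `i·1 ∈ U(N)`. [folklore] -/
theorem trace_I_smul_one_mul (U : Matrix.unitaryGroup (Fin N) ℂ) :
    (((⟨(I : ℂ) • 1, I_smul_one_mem_unitaryGroup⟩ * U : Matrix.unitaryGroup (Fin N) ℂ) :
      Matrix (Fin N) (Fin N) ℂ)).trace = I * ((U : Matrix (Fin N) (Fin N) ℂ)).trace := by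
  show ((((I : ℂ) • (1 : Matrix (Fin N) (Fin N) ℂ)) * (U : Matrix (Fin N) (Fin N) ℂ))).trace = _
  rw [Matrix.smul_mul, one_mul, Matrix.trace_smul, smul_eq_mul]

/-- **`∫_{U(N)} tr U dU = 0`** (every `N`; left invariance under the central `i·1`: the integrand
picks up the factor `i ≠ 1`). [folklore] -/
theorem un_integral_trace_eq_zero :
    ∫ U, ((U : Matrix (Fin N) (Fin N) ℂ)).trace ∂(haarProbability (Matrix.unitaryGroup (Fin N) ℂ)) = 0 := by
  set μ := haarProbability (Matrix.unitaryGroup (Fin N) ℂ) with hμ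
  have key := integral_mul_left_eq_self (μ := μ)
    (fun U : Matrix.unitaryGroup (Fin N) ℂ => ((U : Matrix (Fin N) (Fin N) ℂ)).trace)
    ⟨(I : ℂ) • 1, I_smul_one_mem_unitaryGroup⟩
  simp only [trace_I_smul_one_mul] at key
  rw [integral_const_mul] at key
  have h : (I - 1) * ∫ U, ((U : Matrix (Fin N) (Fin N) ℂ)).trace ∂μ = 0 := by
    rw [sub_mul, one_mul, key, sub_self]
  have hI : (I : ℂ) - 1 ≠ 0 := by
    intro h0
    have := congrArg Complex.re h0
    simp at this
  exact (mul_eq_zero.mp h).resolve_left hI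

/-- **`∫_{U(N)} (tr U)² dU = 0`** (every `N`; the central `i·1` has square `-1 ≠ 1`). [folklore] -/
theorem un_integral_trace_sq_eq_zero :
    ∫ U, ((U : Matrix (Fin N) (Fin N) ℂ)).trace ^ 2
      ∂(haarProbability (Matrix.unitaryGroup (Fin N) ℂ)) = 0 := by
  set μ := haarProbability (Matrix.unitaryGroup (Fin N) ℂ) with hμ
  have key := integral_mul_left_eq_self (μ := μ)
    (fun U : Matrix.unitaryGroup (Fin N) ℂ => ((U : Matrix (Fin N) (Fin N) ℂ)).trace ^ 2)
    ⟨(I : ℂ) • 1, I_smul_one_mem_unitaryGroup⟩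
  simp only [trace_I_smul_one_mul, mul_pow, Complex.I_sq] at key
  rw [integral_const_mul] at key
  -- key : -1 * X = X
  linear_combination (-(1 : ℂ) / 2) * key

/-- **`∫_{U(N)} Re tr U dU = 0`** (every `N`). [folklore] -/
theorem un_integral_re_trace :
    ∫ U, ((U : Matrix (Fin N) (Fin N) ℂ)).trace.re ∂(haarProbability (Matrix.unitaryGroup (Fin N) ℂ)) = 0 := by
  have htr : Continuous fun g : Matrix.unitaryGroup (Fin N) ℂ =>
      ((g : Matrix (Fin N) (Fin N) ℂ)).trace := continuous_subtype_val.matrix_trace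
  rw [← complex_re_integral_eq (integrable_haarUN_of_continuous htr), un_integral_trace_eq_zero,
    Complex.zero_re]

/-- **`∫_{U(N)} (Re tr U)² dU = ½` for every `N ≥ 1`** (`(Re z)² = (|z|² + Re z²)/2`). [ours] -/
theorem un_haarSqReTrace_eq_half (hN : 1 ≤ N) :
    ∫ g, ((g : Matrix (Fin N) (Fin N) ℂ)).trace.re ^ 2
      ∂(haarProbability (Matrix.unitaryGroup (Fin N) ℂ)) = 1 / 2 := by
  set μ := haarProbability (Matrix.unitaryGroup (Fin N) ℂ) with hμ
  have htr : Continuous fun g : Matrix.unitaryGroup (Fin N) ℂ =>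
      ((g : Matrix (Fin N) (Fin N) ℂ)).trace := continuous_subtype_val.matrix_trace
  have h1 : Integrable (fun g : Matrix.unitaryGroup (Fin N) ℂ =>
      Complex.normSq ((g : Matrix (Fin N) (Fin N) ℂ)).trace) μ :=
    integrable_haarUN_of_continuous_real (Complex.continuous_normSq.comp htr)
  have h3 : Integrable (fun g : Matrix.unitaryGroup (Fin N) ℂ =>
      ((g : Matrix (Fin N) (Fin N) ℂ)).trace ^ 2) μ :=
    integrable_haarUN_of_continuous (htr.pow 2)
  have h2 : Integrable (fun g : Matrix.unitaryGroup (Fin N) ℂ =>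
      (((g : Matrix (Fin N) (Fin N) ℂ)).trace ^ 2).re) μ := h3.re
  have hpt : ∀ g : Matrix.unitaryGroup (Fin N) ℂ,
      ((g : Matrix (Fin N) (Fin N) ℂ)).trace.re ^ 2 =
        (1 / 2 : ℝ) * (Complex.normSq ((g : Matrix (Fin N) (Fin N) ℂ)).trace +
          (((g : Matrix (Fin N) (Fin N) ℂ)).trace ^ 2).re) := fun g => by
    rw [Complex.normSq_apply, pow_two, pow_two, Complex.mul_re]
    ring
  simp_rw [hpt]
  rw [integral_const_mul, integral_add h1 h2, un_integral_normSq_trace hN,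
    ← complex_re_integral_eq h3, un_integral_trace_sq_eq_zero, Complex.zero_re]
  norm_num

/-- `Re tr (unitaryFundamentalRep g) = Re tr g`. [folklore] -/
theorem re_trace_unitaryFundamentalRep (g : Matrix.unitaryGroup (Fin N) ℂ) :
    ((unitaryFundamentalRep (Fin N) ℂ g).trace).re = ((g : Matrix (Fin N) (Fin N) ℂ)).trace.re := rfl

/-- **`Var_Haar(Re tr) = ½` on `U(N)`, every `N ≥ 1`** (defining representation). [ours] -/
theorem un_variance_re_trace (hN : 1 ≤ N) :
    variance (fun g : Matrix.unitaryGroup (Fin N) ℂ => ((unitaryFundamentalRep (Fin N) ℂ g).trace).re)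
      (haarProbability (Matrix.unitaryGroup (Fin N) ℂ)) = 1 / 2 := by
  have htr : Continuous fun g : Matrix.unitaryGroup (Fin N) ℂ =>
      ((g : Matrix (Fin N) (Fin N) ℂ)).trace.re :=
    Complex.continuous_re.comp continuous_subtype_val.matrix_trace
  obtain ⟨C, hC⟩ : ∃ C, ∀ g : Matrix.unitaryGroup (Fin N) ℂ,
      ‖((g : Matrix (Fin N) (Fin N) ℂ)).trace.re‖ ≤ C :=
    ⟨_, (BoundedContinuousFunction.mkOfCompact ⟨_, htr⟩).norm_coe_le_norm⟩
  have hm : MemLp (fun g : Matrix.unitaryGroup (Fin N) ℂ => ((g : Matrix (Fin N) (Fin N) ℂ)).trace.re) 2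
      (haarProbability (Matrix.unitaryGroup (Fin N) ℂ)) :=
    MemLp.of_bound htr.aestronglyMeasurable C (ae_of_all _ fun g => hC g)
  simp only [re_trace_unitaryFundamentalRep]
  rw [variance_eq_sub hm]
  simp only [Pi.pow_apply]
  rw [un_haarSqReTrace_eq_half hN, un_integral_re_trace]
  norm_num

/-- The values of the defining representation of `U(N)` are unitary (tautology). [folklore] -/
theorem unitaryFundamentalRep_mem_unitaryGroup (g : Matrix.unitaryGroup (Fin N) ℂ) :
    unitaryFundamentalRep (Fin N) ℂ g ∈ Matrix.unitaryGroup (Fin N) ℂ := g.2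

end Haar

end Summit.Ventures.LatticeQCDFlow.TrivializingMaps
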